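import Literature.Barriers.CriticalPhenomena.PlaquetteWalkHoleRootEastQuadrant
import HarnessLib

/-!
# Barrier catalogue (SAWScalingLimit): KILL-FORCED ZEROS AS A FULLY STRUCTURAL SCHEMA — the free witnesses from a block of
present cells, at every position by translation

Leaf of `PlaquetteWalkHoleRootEastQuadrant` (→ `PlaquetteWalkHoleRootKillForcedZeroWitness` → `PlaquetteWalkHoleRootPrefixLoop`
→ the STRUCTURAL KILL parent; and the QUADRANT leaf). After those files every universal kill of the venture lane's
corner-kill table (LAW L) is a theorem schema at every boundary position, and the kill-forced zero theorems
(`…_exists_eq_zero_Ioo_of_kills_quadrant`, `…_of_east_kills_quadrant`) retain exactly two data hypotheses: the FREE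
WITNESSES (one wound `w₂`-free walk of one route, one wound `w₁`-free walk of the other). This file discharges them
STRUCTURALLY: the witnesses certified by the kernel in the witness leaf live in a 22-cell block around the hole, so they
exist in every face list containing that block — first at the reference position (`YBWalk.mapDomain`), then at every
position by the translation invariance of the vertex functional (`vertexFunctional_printed_shiftBy`,
`YangBaxterSAWHexDictionary`).

* §1 the WEST witness block `westBlock42` (columns `1…5`, rows `0…4`, minus the hole `(3,2)` and the western kill cells
  `(1,0)`, `(1,4)`) with the dead-end witnesses `westOver42` / `westUnder42` redrawn in it and their kernel certificates
  (`ωWB_O_cert`, `ωWB_U_cert`: first hit, length, class, first side, freeness, one eastern-ray crossing).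
* §2 ★★ `exists_over_witness_of_westBlock42` / `exists_under_witness_of_westBlock42` — in EVERY face list containing
  the block the witnesses exist (certificates transferred along `mapDomain` by definitional unfolding); ★★★★
  `exists_eq_zero_of_west_kills_block42` — the western kill-forced zero at the reference position with no walk
  hypothesis.
* §3 ★★★★★ `vertexFunctional_printed_farCellW_exists_eq_zero_Ioo_of_west_kills_block` — **THE WESTERN KILL-FORCED ZERO AS
  A CLOSED SCHEMA**: for every finite face list `Dl` and every plaquette `w`, if `Dl ⊇ westBlock w`, the hole
  `(w.1 − 1, w.2)` and the kill cells `(w.1 − 3, w.2 ∓ 2)` are absent and the far cell's column has no western door below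
  / above the kill rows, then `VF(θ; Dl, w.side W, farW w) = 0` for some `θ ∈ (π/3, 2π/3)` (translate `Dl` back by
  `refShift w = w − (4,2)`, apply §2, translate forward).
* §4 the EAST block `eastBlock42` (minus `(5,0)`, `(5,4)`) with the witnesses `underMids` / `overMids`, ★★
  `exists_under_witness_of_eastBlock42` / `exists_over_witness_of_eastBlock42`, ★★★★ `exists_eq_zero_of_east_kills_block42`,
  ★★★★★ `vertexFunctional_printed_farCellW_exists_eq_zero_Ioo_of_east_kills_block` — **THE EASTERN KILL-FORCED ZERO AS A
  CLOSED SCHEMA** (nothing assumed east of column `w.1 + 1`).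

So the lane's LAW L, found by enumeration on thirteen box frames (`FINDING-YB-KILL-FORCED-ZEROS.md` §5–§6: 33/33
predicted kills, 272/272 cells), is now, in its zero form, a pair of theorems about ALL finite face domains: a `5 × 5`
block of present cells around a hole root, two absent corner cells two rows away on one side, and a column condition
(vacuous in boxes with the hole two rows from the bottom and the top) force an exact zero of the Yang–Baxter vertex
functional strictly between the honeycomb point `π/3` and its dual `2π/3`. Not in print; venture lane «pcv-sawmu», seat
b-step0 gen 25.

References: A. Glazman, I. Manolescu, arXiv:1708.00395v3, §1 (Fig. 1, Fig. 2, the remark after eq. (1)), §2.1, §4.2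
(translation invariance) and Lemma 2.1 [GlazmanManolescu2019]; A. Glazman, Electron. Commun. Probab. 20 (2015) no. 86,
Lemma 3.1, proof pp. 6–7 [Glazman2015WeightedSAW]; R. Courant, H. Robbins, *What is Mathematics?* (1941/1958), Ch. V
Appendix §2 (the even–odd rule) [CourantRobbins1958]; H. Duminil-Copin, S. Smirnov, Ann. of Math. 175 (2012), Lemma 1
[DuminilCopinSmirnov2012].
-/

noncomputable section

open Set Function Complex

namespace Literature.Barriers.CriticalPhenomena.PlaquetteWalk

open Literature.Probability.RandomPlanarGeometry.SAW.YangBaxter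
open Real Complex

/-! ## §1 The WEST witness block at the reference position `w = (4, 2)` and its two witnesses -/

/-- The WEST witness block at the reference root plaquette `(4,2)`: the `5 × 5` block of columns `1…5` and rows `0…4`
minus the hole `(3,2)` and the western kill cells `(1,0)`, `(1,4)` — 22 cells carrying the dead-end witnesses of
`PlaquetteWalkHoleRootKillForcedZeroWitness`. [cite: GlazmanManolescu2019, §2.1 (finite domains of faces)] -/
def westBlock42 : List Face :=
  [(1,1),(1,2),(1,3),(2,0),(2,1),(2,2),(2,3),(2,4),(3,0),(3,1),(3,3),(3,4),(4,0),(4,1),(4,2),(4,3),(4,4),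
    (5,0),(5,1),(5,2),(5,3),(5,4)]

/-- The `w₂`-free wound OVER witness drawn in the west block. [cite: GlazmanManolescu2019, §1 (definition of the model), Fig. 1] -/
def westOver42 : YBWalk (dom westBlock42) (w42.side .W) ((farW w42).side .S) where
  mids := deadEndOverMids
  head_eq := by decide
  getLast_eq := by decide
  nodup := by decide
  arc_mem := arc_mem_of_check (by decide)
  isChain := by decide
  noncross := noncross_of_check (by decide)

/-- The `w₁`-free wound UNDER witness drawn in the west block. [cite: GlazmanManolescu2019, §1 (definition of the model), Fig. 1] -/
def westUnder42 : YBWalk (dom westBlock42) (w42.side .W) ((farW w42).side .N) where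
  mids := deadEndUnderMids
  head_eq := by decide
  getLast_eq := by decide
  nodup := by decide
  arc_mem := arc_mem_of_check (by decide)
  isChain := by decide
  noncross := noncross_of_check (by decide)

/-- The west block's over witness, labelled. [cite: Glazman2015WeightedSAW, Lemma 3.1 (proof, pp. 6–7: the classes of walks through a rhombus)] -/
def ωWB_O : ΩG (dom westBlock42) (w42.side .W) (farW w42) := ⟨.S, westOver42⟩

/-- The west block's under witness, labelled. [cite: Glazman2015WeightedSAW, Lemma 3.1 (proof, pp. 6–7: the classes of walks through a rhombus)] -/
def ωWB_U : ΩG (dom westBlock42) (w42.side .W) (farW w42) := ⟨.N, westUnder42⟩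

/-- The far cell is rooted in the west block. [cite: GlazmanManolescu2019, §2.1 (walks start on the boundary of the domain)] -/
theorem rootedFace_westBlock42 : RootedFace (dom westBlock42) (w42.side .W) (farW w42) :=
  ⟨show farW w42 ∈ westBlock42 by decide,
    show ¬((w42.side .W).faces.1 ∈ westBlock42 ∧ (w42.side .W).faces.2 ∈ westBlock42) by decide⟩

/-- Certificates of the west block's over witness: first hit `4`, `18` arcs, no later arc in the far cell, first side `N`,
`w₂`-free, one eastern-ray crossing. [cite: Glazman2015WeightedSAW, Lemma 3.1 (proof, pp. 6–7)] [cite: CourantRobbins1958, Ch. V Appendix §2 (the even–odd rule)] -/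
theorem ωWB_O_cert : ωWB_O.2.firstHitG = 4 ∧ ωWB_O.2.arcs.length = 18 ∧ (∀ j < 18, 4 < j → ωWB_O.2.fc j ≠ farW w42) ∧
    ωWB_O.2.nth 4 = (farW w42).side .N ∧ ωWB_O.2.W2FreeOff (farW w42) ∧
    Odd ((Finset.range 14).filter fun j => eastRayB w42 (ωWB_O.2.nth (4 + j + 1)) = true).card := by
  refine ⟨by decide, by decide, by decide, by decide, by unfold YBWalk.W2FreeOff; decide, by decide⟩

/-- Certificates of the west block's under witness. [cite: Glazman2015WeightedSAW, Lemma 3.1 (proof, pp. 6–7)] [cite: CourantRobbins1958, Ch. V Appendix §2 (the even–odd rule)] -/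
theorem ωWB_U_cert : ωWB_U.2.firstHitG = 4 ∧ ωWB_U.2.arcs.length = 18 ∧ (∀ j < 18, 4 < j → ωWB_U.2.fc j ≠ farW w42) ∧
    ωWB_U.2.nth 4 = (farW w42).side .S ∧ ωWB_U.2.W1FreeOff (farW w42) ∧
    Odd ((Finset.range 14).filter fun j => eastRayB w42 (ωWB_U.2.nth (4 + j + 1)) = true).card := by
  refine ⟨by decide, by decide, by decide, by decide, by unfold YBWalk.W1FreeOff; decide, by decide⟩

/-! ## §2 Transfer to any face list containing the block (reference position) -/

section WestAt42

variable {Dl : List Face}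

/-- A face list containing the block contains the block's domain. [cite: GlazmanManolescu2019, §2.1 (finite domains of faces)] -/
theorem dom_westBlock42_subset (hB : ∀ c ∈ westBlock42, c ∈ Dl) : dom westBlock42 ⊆ dom Dl := fun c hc => hB c hc

/-- The over witness in a face list containing the west block. [cite: Glazman2015WeightedSAW, Lemma 3.1 (proof, pp. 6–7)] -/
def ωWO_of (hB : ∀ c ∈ westBlock42, c ∈ Dl) : ΩG (dom Dl) (w42.side .W) (farW w42) :=
  ⟨.S, westOver42.mapDomain (dom_westBlock42_subset hB)⟩

/-- The under witness in a face list containing the west block. [cite: Glazman2015WeightedSAW, Lemma 3.1 (proof, pp. 6–7)] -/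
def ωWU_of (hB : ∀ c ∈ westBlock42, c ∈ Dl) : ΩG (dom Dl) (w42.side .W) (farW w42) :=
  ⟨.N, westUnder42.mapDomain (dom_westBlock42_subset hB)⟩

/-- ★★ **THE WEST BLOCK SUPPLIES THE OVER WITNESS** in every face list containing it and missing the hole: a class-`B2a`
over-walk at the far cell, wound at every angle, `w₂`-free off the far cell. [cite: Glazman2015WeightedSAW, Lemma 3.1 (proof, pp. 6–7)]
[cite: CourantRobbins1958, Ch. V Appendix §2 (the even–odd rule)] [cite: GlazmanManolescu2019, Lemma 2.1] -/
theorem exists_over_witness_of_westBlock42 (hB : ∀ c ∈ westBlock42, c ∈ Dl)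
    (hr : RootedFace (dom Dl) (w42.side .W) (farW w42)) (θ : ℝ) :
    ∃ (ω : ΩG (dom Dl) (w42.side .W) (farW w42)) (h : ω.IsB2a), ω.2.firstSideG = .N ∧
      ω.WE (fun _ => θ) ≠ excursionWinding θ ω.2.firstSideG (ω.z1 hr h) ω.1 ∧ ω.2.W2FreeOff (farW w42) := by
  obtain ⟨hF, hn, hfc, hnth, hfree, hodd⟩ := ωWB_O_cert
  have hF' : (ωWO_of hB).2.firstHitG = 4 := hF
  have hn' : (ωWO_of hB).2.arcs.length = 18 := hn
  have h : (ωWO_of hB).IsB2a := by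
    refine ΩG.isB2a_of_forall_fc_ne (by rw [hF', hn']; omega) fun j hj1 hj2 => ?_
    rw [hF'] at hj1
    rw [hn'] at hj2
    exact hfc j hj2 hj1
  refine ⟨ωWO_of hB, h, ΩG.firstSideG_eq_of_nth _ (by rw [hF']; exact hnth), ?_, hfree⟩
  refine ΩG.WE_ne_excursionWinding_of_odd_card _ hr h ?_ θ
  have hM : (ωWO_of hB).Mv = 14 := by unfold ΩG.Mv; rw [hF', hn']
  rw [hM, hF']
  exact hodd

/-- ★★ **THE WEST BLOCK SUPPLIES THE UNDER WITNESS**: a class-`B2a` under-walk, wound, `w₁`-free off the far cell.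
[cite: Glazman2015WeightedSAW, Lemma 3.1 (proof, pp. 6–7)] [cite: CourantRobbins1958, Ch. V Appendix §2 (the even–odd rule)] [cite: GlazmanManolescu2019, Lemma 2.1] -/
theorem exists_under_witness_of_westBlock42 (hB : ∀ c ∈ westBlock42, c ∈ Dl)
    (hr : RootedFace (dom Dl) (w42.side .W) (farW w42)) (θ : ℝ) :
    ∃ (ω : ΩG (dom Dl) (w42.side .W) (farW w42)) (h : ω.IsB2a), ω.2.firstSideG = .S ∧
      ω.WE (fun _ => θ) ≠ excursionWinding θ ω.2.firstSideG (ω.z1 hr h) ω.1 ∧ ω.2.W1FreeOff (farW w42) := by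
  obtain ⟨hF, hn, hfc, hnth, hfree, hodd⟩ := ωWB_U_cert
  have hF' : (ωWU_of hB).2.firstHitG = 4 := hF
  have hn' : (ωWU_of hB).2.arcs.length = 18 := hn
  have h : (ωWU_of hB).IsB2a := by
    refine ΩG.isB2a_of_forall_fc_ne (by rw [hF', hn']; omega) fun j hj1 hj2 => ?_
    rw [hF'] at hj1
    rw [hn'] at hj2
    exact hfc j hj2 hj1
  refine ⟨ωWU_of hB, h, ΩG.firstSideG_eq_of_nth _ (by rw [hF']; exact hnth), ?_, hfree⟩
  refine ΩG.WE_ne_excursionWinding_of_odd_card _ hr h ?_ θ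
  have hM : (ωWU_of hB).Mv = 14 := by unfold ΩG.Mv; rw [hF', hn']
  rw [hM, hF']
  exact hodd

/-- ★★★★ **THE WESTERN KILL-FORCED ZERO, FULLY STRUCTURAL, reference position.** A face list containing the 22-cell west
block around the root plaquette `(4,2)` and missing the hole `(3,2)` and the western kill cells `(1,0)`, `(1,4)`, with no
western door of the far cell's column below row `0` / above row `4` (vacuous for boxes), has an exact zero of the
Yang–Baxter vertex functional at the far cell `(2,2)` in `(π/3, 2π/3)` — NO walk hypothesis: the universal kills are the
quadrant theorems of `PlaquetteWalkHoleRootStructuralKillQuadrant` and the free witnesses come from the block (§1).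
[cite: GlazmanManolescu2019, Lemma 2.1 (statement, "in the form given in [Gl]")]
[cite: GlazmanManolescu2019, §1 (the paragraph of Fig. 2 and the remark after eq. (1))]
[cite: Glazman2015WeightedSAW, Lemma 3.1 (proof, pp. 6–7)] [cite: DuminilCopinSmirnov2012, proof of Lemma 1]
[cite: CourantRobbins1958, Ch. V Appendix §2 (The Jordan Curve Theorem for Polygons: the even–odd rule)] -/
theorem exists_eq_zero_of_west_kills_block42 (Dl : List Face) (hB : ∀ c ∈ westBlock42, c ∈ Dl)
    (hh : holeFaceW w42 ∉ dom Dl) (hKS : killSW w42 ∉ dom Dl) (hKN : killNW w42 ∉ dom Dl)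
    (hcolS : ∀ y : ℤ, y ≤ w42.2 - 3 → (w42.1 - 3, y) ∉ dom Dl ∨ (w42.1 - 2, y) ∉ dom Dl)
    (hcolN : ∀ y : ℤ, w42.2 + 3 ≤ y → (w42.1 - 3, y) ∉ dom Dl ∨ (w42.1 - 2, y) ∉ dom Dl) :
    ∃ θ ∈ Set.Ioo (π / 3) (2 * π / 3),
      vertexFunctional (printedWeights θ) tFiveEighths (ybCoeff θ) Dl (w42.side .W) (farW w42) = 0 := by
  have hf : farW w42 ∈ Dl := hB _ (by decide)
  have hr : RootedFace (dom Dl) (w42.side .W) (farW w42) := ⟨hf, fun hb => hh (by rw [root_faces_W] at hb; exact hb.1)⟩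
  refine vertexFunctional_printed_farCellW_exists_eq_zero_Ioo_of_kills_quadrant Dl w42 hf hh hr hKS hKN
    (fun y hy => ?_) (fun y hy => ?_) (exists_over_witness_of_westBlock42 hB hr _)
    (exists_under_witness_of_westBlock42 hB hr _)
  · rcases hcolS y hy with hc | hc
    · exact Or.inl hc
    · exact Or.inr (Or.inl hc)
  · rcases hcolN y hy with hc | hc
    · exact Or.inl hc
    · exact Or.inr (Or.inl hc)

end WestAt42

/-! ## §3 Every position, by translation -/

/-- The reference translation vector carrying the root plaquette `(4,2)` to `w`. [cite: GlazmanManolescu2019, §4.2 (translation invariance)] -/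
def refShift (w : Face) : ℤ × ℤ := (w.1 - 4, w.2 - 2)

/-- The WEST witness block at the root plaquette `w`: the translate of `westBlock42`. [cite: GlazmanManolescu2019, §2.1 (finite domains of faces), §4.2] -/
def westBlock (w : Face) : List Face := westBlock42.map (Face.shiftBy (refShift w))

/-- The translation carries the reference root plaquette to `w`. [cite: GlazmanManolescu2019, §4.2 (translation invariance)] -/
theorem shiftBy_refShift_w42 (w : Face) : Face.shiftBy (refShift w) w42 = w := by
  obtain ⟨k, j⟩ := w; simp [Face.shiftBy, refShift, w42]

/-- … the reference far cell to the far cell of `w`. [cite: GlazmanManolescu2019, §4.2 (translation invariance)] -/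
theorem shiftBy_refShift_farW (w : Face) : Face.shiftBy (refShift w) (farW w42) = farW w := by
  obtain ⟨k, j⟩ := w; simp [Face.shiftBy, refShift, w42, farW]; ring

/-- … the reference hole to the hole of `w`. [cite: GlazmanManolescu2019, §4.2 (translation invariance)] -/
theorem shiftBy_refShift_holeFaceW (w : Face) : Face.shiftBy (refShift w) (holeFaceW w42) = holeFaceW w := by
  obtain ⟨k, j⟩ := w; simp [Face.shiftBy, refShift, w42, holeFaceW]; ring

/-- … the reference root to the root of `w`. [cite: GlazmanManolescu2019, §4.2 (translation invariance)] -/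
theorem shiftBy_refShift_root (w : Face) : (w42.side .W).shiftBy (refShift w) = w.side .W := by
  rw [← Face.side_shiftBy, shiftBy_refShift_w42]

/-- … a reference cell `(4 + dx, 2 + dy)` to `(w.1 + dx, w.2 + dy)`. [cite: GlazmanManolescu2019, §4.2 (translation invariance)] -/
theorem shiftBy_refShift_mk (w : Face) (x y : ℤ) : Face.shiftBy (refShift w) ((x, y) : Face) = (x + (w.1 - 4), y + (w.2 - 2)) := by
  simp [Face.shiftBy, refShift]

/-- Membership in the domain of the back-translated list. [cite: GlazmanManolescu2019, §4.2 (translation invariance)] -/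
theorem mem_dom_map_shiftBy_neg (v : ℤ × ℤ) (Dl : List Face) (c : Face) :
    c ∈ dom (Dl.map (Face.shiftBy (-v))) ↔ Face.shiftBy v c ∈ dom Dl := by
  rw [dom_map_shiftBy (-v) Dl, neg_neg]; rfl

/-- Translating back and forth restores the list. [cite: GlazmanManolescu2019, §4.2 (translation invariance)] -/
theorem map_shiftBy_map_shiftBy_neg (v : ℤ × ℤ) (Dl : List Face) :
    (Dl.map (Face.shiftBy (-v))).map (Face.shiftBy v) = Dl := by
  rw [List.map_map]
  conv_rhs => rw [← List.map_id Dl]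
  refine List.map_congr_left fun c _ => ?_
  simp

/-- ★★★★★ **THE WESTERN KILL-FORCED ZERO AS A FULLY STRUCTURAL SCHEMA.** For EVERY finite face list `Dl` and EVERY
plaquette `w`: if `Dl` contains the 22-cell west witness block `westBlock w` (the `5 × 5` block of columns `w.1 − 3 … w.1 + 1`
and rows `w.2 − 2 … w.2 + 2` minus the hole and the two western kill cells), misses the hole `(w.1 − 1, w.2)` and the
western kill cells `K_S2 = (w.1 − 3, w.2 − 2)`, `K_N1 = (w.1 − 3, w.2 + 2)`, and the far cell's column has no western door
below the lower / above the upper kill row (vacuous in a box whose hole sits two rows from the bottom and the top),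
then the Yang–Baxter vertex functional of the printed weights, rooted at the `W` side of `w`, has an EXACT ZERO at the far
cell `(w.1 − 2, w.2)` for some `θ ∈ (π/3, 2π/3)`. No walk is quantified in the hypotheses: the universal kills are the
quadrant theorems, the free witnesses are the block's explicit walks translated to `w` — via the translation
invariance of the vertex functional (`vertexFunctional_printed_shiftBy`). This is the west pair of the venture lane's
LAW L as one closed theorem schema. [cite: GlazmanManolescu2019, Lemma 2.1 (statement, "in the form given in [Gl]"), §4.2 (translation invariance)]
[cite: GlazmanManolescu2019, §1 (the paragraph of Fig. 2 and the remark after eq. (1))]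
[cite: Glazman2015WeightedSAW, Lemma 3.1 (proof, pp. 6–7)] [cite: DuminilCopinSmirnov2012, proof of Lemma 1]
[cite: CourantRobbins1958, Ch. V Appendix §2 (The Jordan Curve Theorem for Polygons: the even–odd rule)] -/
theorem vertexFunctional_printed_farCellW_exists_eq_zero_Ioo_of_west_kills_block (Dl : List Face) (w : Face)
    (hB : ∀ c ∈ westBlock w, c ∈ Dl) (hh : holeFaceW w ∉ dom Dl) (hKS : killSW w ∉ dom Dl) (hKN : killNW w ∉ dom Dl)
    (hcolS : ∀ y : ℤ, y ≤ w.2 - 3 → (w.1 - 3, y) ∉ dom Dl ∨ (w.1 - 2, y) ∉ dom Dl)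
    (hcolN : ∀ y : ℤ, w.2 + 3 ≤ y → (w.1 - 3, y) ∉ dom Dl ∨ (w.1 - 2, y) ∉ dom Dl) :
    ∃ θ ∈ Set.Ioo (π / 3) (2 * π / 3),
      vertexFunctional (printedWeights θ) tFiveEighths (ybCoeff θ) Dl (w.side .W) (farW w) = 0 := by
  set v := refShift w with hv
  set Dl₀ := Dl.map (Face.shiftBy (-v)) with hDl₀
  have mem0 : ∀ c : Face, c ∈ dom Dl₀ ↔ Face.shiftBy v c ∈ dom Dl := mem_dom_map_shiftBy_neg v Dl
  have hB0 : ∀ c ∈ westBlock42, c ∈ Dl₀ := by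
    intro c hc
    have h1 : Face.shiftBy v c ∈ westBlock w := List.mem_map.2 ⟨c, hc, rfl⟩
    exact (mem0 c).2 (hB _ h1)
  have hh0 : holeFaceW w42 ∉ dom Dl₀ := by rw [mem0, shiftBy_refShift_holeFaceW]; exact hh
  have hKS0 : killSW w42 ∉ dom Dl₀ := by
    rw [mem0, show killSW w42 = ((1 : ℤ), (0 : ℤ)) by rfl, shiftBy_refShift_mk]
    have e : ((1 + (w.1 - 4), 0 + (w.2 - 2)) : Face) = killSW w := Prod.ext (by simp [killSW]; ring) (by simp [killSW])
    rw [e]; exact hKS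
  have hKN0 : killNW w42 ∉ dom Dl₀ := by
    rw [mem0, show killNW w42 = ((1 : ℤ), (4 : ℤ)) by rfl, shiftBy_refShift_mk]
    have e : ((1 + (w.1 - 4), 4 + (w.2 - 2)) : Face) = killNW w := Prod.ext (by simp [killNW]; ring) (by simp [killNW]; ring)
    rw [e]; exact hKN
  have hcolS0 : ∀ y : ℤ, y ≤ w42.2 - 3 → (w42.1 - 3, y) ∉ dom Dl₀ ∨ (w42.1 - 2, y) ∉ dom Dl₀ := by
    intro y hy
    simp only [w42] at hy ⊢
    rw [show ((4 : ℤ) - 3, y) = ((1 : ℤ), y) by norm_num, show ((4 : ℤ) - 2, y) = ((2 : ℤ), y) by norm_num, mem0, mem0,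
      shiftBy_refShift_mk, shiftBy_refShift_mk]
    have e1 : ((1 + (w.1 - 4), y + (w.2 - 2)) : Face) = (w.1 - 3, y + (w.2 - 2)) := by
      refine Prod.ext ?_ rfl; show 1 + (w.1 - 4) = w.1 - 3; ring
    have e2 : ((2 + (w.1 - 4), y + (w.2 - 2)) : Face) = (w.1 - 2, y + (w.2 - 2)) := by
      refine Prod.ext ?_ rfl; show 2 + (w.1 - 4) = w.1 - 2; ring
    rw [e1, e2]
    exact hcolS _ (by omega)
  have hcolN0 : ∀ y : ℤ, w42.2 + 3 ≤ y → (w42.1 - 3, y) ∉ dom Dl₀ ∨ (w42.1 - 2, y) ∉ dom Dl₀ := by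
    intro y hy
    simp only [w42] at hy ⊢
    rw [show ((4 : ℤ) - 3, y) = ((1 : ℤ), y) by norm_num, show ((4 : ℤ) - 2, y) = ((2 : ℤ), y) by norm_num, mem0, mem0,
      shiftBy_refShift_mk, shiftBy_refShift_mk]
    have e1 : ((1 + (w.1 - 4), y + (w.2 - 2)) : Face) = (w.1 - 3, y + (w.2 - 2)) := by
      refine Prod.ext ?_ rfl; show 1 + (w.1 - 4) = w.1 - 3; ring
    have e2 : ((2 + (w.1 - 4), y + (w.2 - 2)) : Face) = (w.1 - 2, y + (w.2 - 2)) := by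
      refine Prod.ext ?_ rfl; show 2 + (w.1 - 4) = w.1 - 2; ring
    rw [e1, e2]
    exact hcolN _ (by omega)
  obtain ⟨θ, hθ, hz⟩ := exists_eq_zero_of_west_kills_block42 Dl₀ hB0 hh0 hKS0 hKN0 hcolS0 hcolN0
  refine ⟨θ, hθ, ?_⟩
  have key := vertexFunctional_printed_shiftBy v θ Dl₀ (w42.side .W) (farW w42)
  rw [hDl₀, map_shiftBy_map_shiftBy_neg, hv, shiftBy_refShift_root, shiftBy_refShift_farW] at key
  rw [key]
  exact hz

/-! ## §4 The EAST pair: the east witness block and the eastern schema -/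

/-- The EAST witness block at the reference root plaquette `(4,2)`: columns `1…5`, rows `0…4`, minus the hole `(3,2)` and
the eastern kill cells `(5,0)`, `(5,4)` — 22 cells carrying the witnesses `underMids` / `overMids` of
`PlaquetteWalkHoleRootKillForcedZeroWitness`. [cite: GlazmanManolescu2019, §2.1 (finite domains of faces)] -/
def eastBlock42 : List Face :=
  [(1,0),(1,1),(1,2),(1,3),(1,4),(2,0),(2,1),(2,2),(2,3),(2,4),(3,0),(3,1),(3,3),(3,4),(4,0),(4,1),(4,2),(4,3),(4,4),
    (5,1),(5,2),(5,3)]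

/-- The `w₂`-free wound UNDER witness drawn in the east block. [cite: GlazmanManolescu2019, §1 (definition of the model), Fig. 1] -/
def eastUnder42 : YBWalk (dom eastBlock42) (w42.side .W) ((farW w42).side .N) where
  mids := underMids
  head_eq := by decide
  getLast_eq := by decide
  nodup := by decide
  arc_mem := arc_mem_of_check (by decide)
  isChain := by decide
  noncross := noncross_of_check (by decide)

/-- The `w₁`-free wound OVER witness drawn in the east block. [cite: GlazmanManolescu2019, §1 (definition of the model), Fig. 1] -/
def eastOver42 : YBWalk (dom eastBlock42) (w42.side .W) ((farW w42).side .S) where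
  mids := overMids
  head_eq := by decide
  getLast_eq := by decide
  nodup := by decide
  arc_mem := arc_mem_of_check (by decide)
  isChain := by decide
  noncross := noncross_of_check (by decide)

/-- The east block's under witness, labelled. [cite: Glazman2015WeightedSAW, Lemma 3.1 (proof, pp. 6–7: the classes of walks through a rhombus)] -/
def ωEB_U : ΩG (dom eastBlock42) (w42.side .W) (farW w42) := ⟨.N, eastUnder42⟩

/-- The east block's over witness, labelled. [cite: Glazman2015WeightedSAW, Lemma 3.1 (proof, pp. 6–7: the classes of walks through a rhombus)] -/
def ωEB_O : ΩG (dom eastBlock42) (w42.side .W) (farW w42) := ⟨.S, eastOver42⟩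

/-- Certificates of the east block's under witness. [cite: Glazman2015WeightedSAW, Lemma 3.1 (proof, pp. 6–7)] [cite: CourantRobbins1958, Ch. V Appendix §2 (the even–odd rule)] -/
theorem ωEB_U_cert : ωEB_U.2.firstHitG = 4 ∧ ωEB_U.2.arcs.length = 18 ∧ (∀ j < 18, 4 < j → ωEB_U.2.fc j ≠ farW w42) ∧
    ωEB_U.2.nth 4 = (farW w42).side .S ∧ ωEB_U.2.W2FreeOff (farW w42) ∧
    Odd ((Finset.range 14).filter fun j => eastRayB w42 (ωEB_U.2.nth (4 + j + 1)) = true).card := by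
  refine ⟨by decide, by decide, by decide, by decide, by unfold YBWalk.W2FreeOff; decide, by decide⟩

/-- Certificates of the east block's over witness. [cite: Glazman2015WeightedSAW, Lemma 3.1 (proof, pp. 6–7)] [cite: CourantRobbins1958, Ch. V Appendix §2 (the even–odd rule)] -/
theorem ωEB_O_cert : ωEB_O.2.firstHitG = 4 ∧ ωEB_O.2.arcs.length = 18 ∧ (∀ j < 18, 4 < j → ωEB_O.2.fc j ≠ farW w42) ∧
    ωEB_O.2.nth 4 = (farW w42).side .N ∧ ωEB_O.2.W1FreeOff (farW w42) ∧
    Odd ((Finset.range 14).filter fun j => eastRayB w42 (ωEB_O.2.nth (4 + j + 1)) = true).card := by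
  refine ⟨by decide, by decide, by decide, by decide, by unfold YBWalk.W1FreeOff; decide, by decide⟩

section EastAt42

variable {Dl : List Face}

/-- A face list containing the east block contains the block's domain. [cite: GlazmanManolescu2019, §2.1 (finite domains of faces)] -/
theorem dom_eastBlock42_subset (hB : ∀ c ∈ eastBlock42, c ∈ Dl) : dom eastBlock42 ⊆ dom Dl := fun c hc => hB c hc

/-- The under witness in a face list containing the east block. [cite: Glazman2015WeightedSAW, Lemma 3.1 (proof, pp. 6–7)] -/
def ωEU_of (hB : ∀ c ∈ eastBlock42, c ∈ Dl) : ΩG (dom Dl) (w42.side .W) (farW w42) :=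
  ⟨.N, eastUnder42.mapDomain (dom_eastBlock42_subset hB)⟩

/-- The over witness in a face list containing the east block. [cite: Glazman2015WeightedSAW, Lemma 3.1 (proof, pp. 6–7)] -/
def ωEO_of (hB : ∀ c ∈ eastBlock42, c ∈ Dl) : ΩG (dom Dl) (w42.side .W) (farW w42) :=
  ⟨.S, eastOver42.mapDomain (dom_eastBlock42_subset hB)⟩

/-- ★★ **THE EAST BLOCK SUPPLIES THE UNDER WITNESS**: a class-`B2a` under-walk, wound at every angle, `w₂`-free off the far
cell. [cite: Glazman2015WeightedSAW, Lemma 3.1 (proof, pp. 6–7)] [cite: CourantRobbins1958, Ch. V Appendix §2 (the even–odd rule)] [cite: GlazmanManolescu2019, Lemma 2.1] -/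
theorem exists_under_witness_of_eastBlock42 (hB : ∀ c ∈ eastBlock42, c ∈ Dl)
    (hr : RootedFace (dom Dl) (w42.side .W) (farW w42)) (θ : ℝ) :
    ∃ (ω : ΩG (dom Dl) (w42.side .W) (farW w42)) (h : ω.IsB2a), ω.2.firstSideG = .S ∧
      ω.WE (fun _ => θ) ≠ excursionWinding θ ω.2.firstSideG (ω.z1 hr h) ω.1 ∧ ω.2.W2FreeOff (farW w42) := by
  obtain ⟨hF, hn, hfc, hnth, hfree, hodd⟩ := ωEB_U_cert
  have hF' : (ωEU_of hB).2.firstHitG = 4 := hF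
  have hn' : (ωEU_of hB).2.arcs.length = 18 := hn
  have h : (ωEU_of hB).IsB2a := by
    refine ΩG.isB2a_of_forall_fc_ne (by rw [hF', hn']; omega) fun j hj1 hj2 => ?_
    rw [hF'] at hj1
    rw [hn'] at hj2
    exact hfc j hj2 hj1
  refine ⟨ωEU_of hB, h, ΩG.firstSideG_eq_of_nth _ (by rw [hF']; exact hnth), ?_, hfree⟩
  refine ΩG.WE_ne_excursionWinding_of_odd_card _ hr h ?_ θ
  have hM : (ωEU_of hB).Mv = 14 := by unfold ΩG.Mv; rw [hF', hn']
  rw [hM, hF']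
  exact hodd

/-- ★★ **THE EAST BLOCK SUPPLIES THE OVER WITNESS**: a class-`B2a` over-walk, wound, `w₁`-free off the far cell.
[cite: Glazman2015WeightedSAW, Lemma 3.1 (proof, pp. 6–7)] [cite: CourantRobbins1958, Ch. V Appendix §2 (the even–odd rule)] [cite: GlazmanManolescu2019, Lemma 2.1] -/
theorem exists_over_witness_of_eastBlock42 (hB : ∀ c ∈ eastBlock42, c ∈ Dl)
    (hr : RootedFace (dom Dl) (w42.side .W) (farW w42)) (θ : ℝ) :
    ∃ (ω : ΩG (dom Dl) (w42.side .W) (farW w42)) (h : ω.IsB2a), ω.2.firstSideG = .N ∧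
      ω.WE (fun _ => θ) ≠ excursionWinding θ ω.2.firstSideG (ω.z1 hr h) ω.1 ∧ ω.2.W1FreeOff (farW w42) := by
  obtain ⟨hF, hn, hfc, hnth, hfree, hodd⟩ := ωEB_O_cert
  have hF' : (ωEO_of hB).2.firstHitG = 4 := hF
  have hn' : (ωEO_of hB).2.arcs.length = 18 := hn
  have h : (ωEO_of hB).IsB2a := by
    refine ΩG.isB2a_of_forall_fc_ne (by rw [hF', hn']; omega) fun j hj1 hj2 => ?_
    rw [hF'] at hj1
    rw [hn'] at hj2
    exact hfc j hj2 hj1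
  refine ⟨ωEO_of hB, h, ΩG.firstSideG_eq_of_nth _ (by rw [hF']; exact hnth), ?_, hfree⟩
  refine ΩG.WE_ne_excursionWinding_of_odd_card _ hr h ?_ θ
  have hM : (ωEO_of hB).Mv = 14 := by unfold ΩG.Mv; rw [hF', hn']
  rw [hM, hF']
  exact hodd

/-- ★★★★ **THE EASTERN KILL-FORCED ZERO, FULLY STRUCTURAL, reference position** — east block present, hole and the two
eastern kill cells `(5,0)`, `(5,4)` absent, no western door of column `5` below row `0` / above row `4` ⇒ an exact zero at
the far cell `(2,2)` in `(π/3, 2π/3)`; no walk hypothesis (kills: `PlaquetteWalkHoleRootEastQuadrant`; witnesses: the block).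
[cite: GlazmanManolescu2019, Lemma 2.1 (statement, "in the form given in [Gl]")]
[cite: GlazmanManolescu2019, §1 (the paragraph of Fig. 2 and the remark after eq. (1))]
[cite: Glazman2015WeightedSAW, Lemma 3.1 (proof, pp. 6–7)] [cite: DuminilCopinSmirnov2012, proof of Lemma 1]
[cite: CourantRobbins1958, Ch. V Appendix §2 (The Jordan Curve Theorem for Polygons: the even–odd rule)] -/
theorem exists_eq_zero_of_east_kills_block42 (Dl : List Face) (hB : ∀ c ∈ eastBlock42, c ∈ Dl)
    (hh : holeFaceW w42 ∉ dom Dl) (hKS : killSE w42 ∉ dom Dl) (hKN : killNE w42 ∉ dom Dl)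
    (hcolS : ∀ y : ℤ, y ≤ w42.2 - 3 → (w42.1, y) ∉ dom Dl ∨ (w42.1 + 1, y) ∉ dom Dl)
    (hcolN : ∀ y : ℤ, w42.2 + 3 ≤ y → (w42.1, y) ∉ dom Dl ∨ (w42.1 + 1, y) ∉ dom Dl) :
    ∃ θ ∈ Set.Ioo (π / 3) (2 * π / 3),
      vertexFunctional (printedWeights θ) tFiveEighths (ybCoeff θ) Dl (w42.side .W) (farW w42) = 0 := by
  have hf : farW w42 ∈ Dl := hB _ (by decide)
  have hr : RootedFace (dom Dl) (w42.side .W) (farW w42) := ⟨hf, fun hb => hh (by rw [root_faces_W] at hb; exact hb.1)⟩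
  exact vertexFunctional_printed_farCellW_exists_eq_zero_Ioo_of_east_kills_quadrant Dl w42 hf hh hr hKN hcolN hKS hcolS
    (exists_under_witness_of_eastBlock42 hB hr _) (exists_over_witness_of_eastBlock42 hB hr _)

end EastAt42

/-- The EAST witness block at the root plaquette `w`: the translate of `eastBlock42`. [cite: GlazmanManolescu2019, §2.1 (finite domains of faces), §4.2] -/
def eastBlock (w : Face) : List Face := eastBlock42.map (Face.shiftBy (refShift w))

/-- ★★★★★ **THE EASTERN KILL-FORCED ZERO AS A FULLY STRUCTURAL SCHEMA.** For EVERY finite face list `Dl` and EVERY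
plaquette `w`: if `Dl` contains the 22-cell east witness block `eastBlock w` (columns `w.1 − 3 … w.1 + 1`, rows `w.2 − 2 …
w.2 + 2`, minus the hole and the two eastern kill cells), misses the hole `(w.1 − 1, w.2)` and the eastern kill cells
`K_S1 = (w.1 + 1, w.2 − 2)`, `K_N2 = (w.1 + 1, w.2 + 2)`, and column `w.1 + 1` has no western door below the lower / above
the upper kill row (vacuous in a box whose hole sits two rows from the bottom and the top) — and WHATEVER lies east of
column `w.1 + 1` — then the Yang–Baxter vertex functional of the printed weights, rooted at the `W` side of `w`, has an
EXACT ZERO at the far cell for some `θ ∈ (π/3, 2π/3)`. The east pair of the venture lane's LAW L as one closed theorem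
schema. [cite: GlazmanManolescu2019, Lemma 2.1 (statement, "in the form given in [Gl]"), §4.2 (translation invariance)]
[cite: GlazmanManolescu2019, §1 (the paragraph of Fig. 2 and the remark after eq. (1))]
[cite: Glazman2015WeightedSAW, Lemma 3.1 (proof, pp. 6–7)] [cite: DuminilCopinSmirnov2012, proof of Lemma 1]
[cite: CourantRobbins1958, Ch. V Appendix §2 (The Jordan Curve Theorem for Polygons: the even–odd rule)] -/
theorem vertexFunctional_printed_farCellW_exists_eq_zero_Ioo_of_east_kills_block (Dl : List Face) (w : Face)
    (hB : ∀ c ∈ eastBlock w, c ∈ Dl) (hh : holeFaceW w ∉ dom Dl) (hKS : killSE w ∉ dom Dl) (hKN : killNE w ∉ dom Dl)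
    (hcolS : ∀ y : ℤ, y ≤ w.2 - 3 → (w.1, y) ∉ dom Dl ∨ (w.1 + 1, y) ∉ dom Dl)
    (hcolN : ∀ y : ℤ, w.2 + 3 ≤ y → (w.1, y) ∉ dom Dl ∨ (w.1 + 1, y) ∉ dom Dl) :
    ∃ θ ∈ Set.Ioo (π / 3) (2 * π / 3),
      vertexFunctional (printedWeights θ) tFiveEighths (ybCoeff θ) Dl (w.side .W) (farW w) = 0 := by
  set v := refShift w with hv
  set Dl₀ := Dl.map (Face.shiftBy (-v)) with hDl₀
  have mem0 : ∀ c : Face, c ∈ dom Dl₀ ↔ Face.shiftBy v c ∈ dom Dl := mem_dom_map_shiftBy_neg v Dl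
  have hB0 : ∀ c ∈ eastBlock42, c ∈ Dl₀ := by
    intro c hc
    have h1 : Face.shiftBy v c ∈ eastBlock w := List.mem_map.2 ⟨c, hc, rfl⟩
    exact (mem0 c).2 (hB _ h1)
  have hh0 : holeFaceW w42 ∉ dom Dl₀ := by rw [mem0, shiftBy_refShift_holeFaceW]; exact hh
  have hKS0 : killSE w42 ∉ dom Dl₀ := by
    rw [mem0, show killSE w42 = ((5 : ℤ), (0 : ℤ)) by rfl, shiftBy_refShift_mk]
    have e : ((5 + (w.1 - 4), 0 + (w.2 - 2)) : Face) = killSE w := Prod.ext (by simp [killSE]; ring) (by simp [killSE])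
    rw [e]; exact hKS
  have hKN0 : killNE w42 ∉ dom Dl₀ := by
    rw [mem0, show killNE w42 = ((5 : ℤ), (4 : ℤ)) by rfl, shiftBy_refShift_mk]
    have e : ((5 + (w.1 - 4), 4 + (w.2 - 2)) : Face) = killNE w := Prod.ext (by simp [killNE]; ring) (by simp [killNE]; ring)
    rw [e]; exact hKN
  have hcolS0 : ∀ y : ℤ, y ≤ w42.2 - 3 → (w42.1, y) ∉ dom Dl₀ ∨ (w42.1 + 1, y) ∉ dom Dl₀ := by
    intro y hy
    simp only [w42] at hy ⊢
    rw [show ((4 : ℤ) + 1, y) = ((5 : ℤ), y) by norm_num, mem0, mem0, shiftBy_refShift_mk, shiftBy_refShift_mk]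
    have e1 : ((4 + (w.1 - 4), y + (w.2 - 2)) : Face) = (w.1, y + (w.2 - 2)) := by
      refine Prod.ext ?_ rfl; show 4 + (w.1 - 4) = w.1; ring
    have e2 : ((5 + (w.1 - 4), y + (w.2 - 2)) : Face) = (w.1 + 1, y + (w.2 - 2)) := by
      refine Prod.ext ?_ rfl; show 5 + (w.1 - 4) = w.1 + 1; ring
    rw [e1, e2]
    exact hcolS _ (by omega)
  have hcolN0 : ∀ y : ℤ, w42.2 + 3 ≤ y → (w42.1, y) ∉ dom Dl₀ ∨ (w42.1 + 1, y) ∉ dom Dl₀ := by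
    intro y hy
    simp only [w42] at hy ⊢
    rw [show ((4 : ℤ) + 1, y) = ((5 : ℤ), y) by norm_num, mem0, mem0, shiftBy_refShift_mk, shiftBy_refShift_mk]
    have e1 : ((4 + (w.1 - 4), y + (w.2 - 2)) : Face) = (w.1, y + (w.2 - 2)) := by
      refine Prod.ext ?_ rfl; show 4 + (w.1 - 4) = w.1; ring
    have e2 : ((5 + (w.1 - 4), y + (w.2 - 2)) : Face) = (w.1 + 1, y + (w.2 - 2)) := by
      refine Prod.ext ?_ rfl; show 5 + (w.1 - 4) = w.1 + 1; ring
    rw [e1, e2]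
    exact hcolN _ (by omega)
  obtain ⟨θ, hθ, hz⟩ := exists_eq_zero_of_east_kills_block42 Dl₀ hB0 hh0 hKS0 hKN0 hcolS0 hcolN0
  refine ⟨θ, hθ, ?_⟩
  have key := vertexFunctional_printed_shiftBy v θ Dl₀ (w42.side .W) (farW w42)
  rw [hDl₀, map_shiftBy_map_shiftBy_neg, hv, shiftBy_refShift_root, shiftBy_refShift_farW] at key
  rw [key]
  exact hz

end Literature.Barriers.CriticalPhenomena.PlaquetteWalk
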